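import Mathlib
import Summits.Ventures.PercRepro.TriangleCapCherryTable

/-!
# PercRepro — THE CONJECTURE §10av VERBATIM: `max(STAR(k, m), (m (k − 2) − r (k − r − 1)) / 2)` WITH
`r = δ(m) − m`, `δ(m) = min {a (k − a) : a (k − a) ≥ m}` (p3, gen 40; part 165)

The closed form of the `K₄⁻`-free cherry table as conjectured in §10av(a), on every cell `k ≥ 6`, `4m ≤ k²`:
**`closed_form_conjecture (k m) (hk : 6 ≤ k) (hm : 4m ≤ k²)`** — there are `δ` (the least product `a (k − a)`
with `a ≤ k` that is `≥ m`, spelled out) and `r = δ − m` such that the attained maximum `M` of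
`Σ_v C(d(v), 2)` over the `K₄⁻`-free graphs on `Fin k` with `m` edges satisfies
`2M = max (2·STAR(k, m)) (m (k − 2) − r (k − 1 − r))`, where `STAR(k, m) = C(m, 2)` for `m ≤ k − 1` and
`C(k − 1, 2) + 2 (m + 1 − k)` for `m ≥ k` (the star plus a matching; dominated by the bipartite term exactly as the
conjecture says when the matching does not fit). Below `2k − 3` the least product is `k − 1` (`m ≤ k − 1`, where
both terms are `C(m, 2)`) or `2 (k − 2)` (`k ≤ m ≤ 2k − 4`, where the second term is the value
`C(k − 2, 2) + C(t + 1, 2) + t + 1` of part 114); from `2k − 3` on the star term is dominated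
(`r (k − 1 − r) ≤ (m − k + 1)(k − 6)`) and the value is part 163's. Axioms: standard.
-/

namespace PercRepro

namespace TriangleCap

namespace C047

open Finset

/-- The least product `a (k − a)` above `m` is `k − 1` when `1 ≤ m ≤ k − 1`. -/
theorem least_prod_of_le (k m : ℕ) (hk : 4 ≤ k) (hm1 : 1 ≤ m) (hmk : m + 1 ≤ k) :
    ∀ a', a' ≤ k → m ≤ a' * (k - a') → k - 1 ≤ a' * (k - a') := by
  intro a' ha' hma'
  rcases Nat.eq_zero_or_pos a' with h0 | h0
  · subst h0; simp at hma'; omega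
  rcases Nat.lt_or_ge a' k with hlt | hge
  · have := prod_ge_of_between a' k 1 h0 (by omega)
    simpa using this
  · have : a' = k := by omega
    subst this
    simp at hma'
    omega

/-- The least product `a (k − a)` above `m` is `2 (k − 2)` when `k ≤ m ≤ 2k − 4`. -/
theorem least_prod_of_mid (k m : ℕ) (hk : 4 ≤ k) (hmk : k ≤ m) (hm2 : m + 4 ≤ 2 * k) :
    ∀ a', a' ≤ k → m ≤ a' * (k - a') → 2 * (k - 2) ≤ a' * (k - a') := by
  intro a' ha' hma'
  rcases Nat.lt_or_ge a' 2 with h1 | h2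
  · interval_cases a'
    · simp at hma'; omega
    · simp at hma'; omega
  rcases Nat.lt_or_ge a' (k - 1) with hlt | hge
  · exact prod_ge_of_between a' k 2 h2 (by omega)
  · have : a' = k - 1 ∨ a' = k := by omega
    rcases this with h | h
    · subst h
      have e : k - (k - 1) = 1 := by omega
      rw [e] at hma'
      omega
    · subst h
      simp at hma'
      omega

/-- The least product `a (k − a)` above `m` is `a (k − a)` itself on a cell `(k, a, r)` with `2a + r ≤ k`. -/
theorem least_prod_of_cell (k a r m : ℕ) (ha : 3 ≤ a) (hak : 2 * a + r ≤ k) (hm : a * (k - a) = m + r) :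
    ∀ a', a' ≤ k → m ≤ a' * (k - a') → a * (k - a) ≤ a' * (k - a') := by
  intro a' ha' hma'
  by_cases hsmall : a' ≤ a - 1 ∨ k ≤ a' + (a - 1)
  · -- `a′ (k − a′) ≤ (a − 1)(k − a + 1) < m`
    have h := prod_le_of_small a' k (a - 1) ha' (by omega) hsmall
    obtain ⟨a₁, rfl⟩ : ∃ a₁, a = a₁ + 1 := ⟨a - 1, by omega⟩
    obtain ⟨c, hc⟩ : ∃ c, k = a₁ + 1 + c := ⟨k - (a₁ + 1), by omega⟩
    have e1 : a₁ + 1 - 1 = a₁ := by omega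
    rw [e1] at h
    rw [hc] at h hm
    have e2 : a₁ + 1 + c - a₁ = c + 1 := by omega
    have e3 : a₁ + 1 + c - (a₁ + 1) = c := by omega
    rw [e2] at h
    rw [e3] at hm
    rw [hc] at hma' hak
    have h1 : a₁ * (c + 1) = a₁ * c + a₁ := by ring
    have h2 : (a₁ + 1) * c = a₁ * c + c := by ring
    exfalso
    omega
  · push Not at hsmall
    exact prod_ge_of_between a' k a (by omega) (by omega)

/-- `2·STAR(k, m) ≤ m (k − 2) − r (k − 1 − r)` on the cells from `2k − 3` on (`r + 2a ≤ k`, `3 ≤ a`,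
`a (k − a) = m + r`): the star term is dominated. -/
theorem star_le_closed (k a r m : ℕ) (ha : 3 ≤ a) (hak : 2 * a + r ≤ k) (hm : a * (k - a) = m + r) :
    (k - 1) * (k - 2) + 4 * (m + 1 - k) + r * (k - 1 - r) ≤ m * (k - 2) := by
  obtain ⟨a₂, rfl⟩ : ∃ a₂, a = a₂ + 3 := ⟨a - 3, by omega⟩
  obtain ⟨j, rfl⟩ : ∃ j, k = 2 * (a₂ + 3) + r + j := ⟨k - (2 * (a₂ + 3) + r), by omega⟩
  have e1 : 2 * (a₂ + 3) + r + j - (a₂ + 3) = a₂ + 3 + r + j := by omega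
  rw [e1] at hm
  have hm' : m = (a₂ + 3) * (a₂ + 3 + r + j) - r := by omega
  have hmr : r ≤ (a₂ + 3) * (a₂ + 3 + r + j) := by nlinarith
  obtain ⟨q, hq⟩ : ∃ q, (a₂ + 3) * (a₂ + 3 + r + j) = r + q := ⟨(a₂ + 3) * (a₂ + 3 + r + j) - r, by omega⟩
  have hmq : m = q := by omega
  subst hmq
  have e2 : 2 * (a₂ + 3) + r + j - 1 = 2 * a₂ + 5 + r + j := by omega
  have e3 : 2 * (a₂ + 3) + r + j - 2 = 2 * a₂ + 4 + r + j := by omega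
  have e4 : 2 * (a₂ + 3) + r + j - 1 - r = 2 * a₂ + 5 + j := by omega
  have hqk : 2 * (a₂ + 3) + r + j ≤ m + 1 := by nlinarith
  rw [e4, e2, e3]
  obtain ⟨s, hs⟩ : ∃ s, m + 1 = 2 * (a₂ + 3) + r + j + s := ⟨m + 1 - (2 * (a₂ + 3) + r + j), by omega⟩
  have e6 : m + 1 - (2 * (a₂ + 3) + r + j) = s := by omega
  rw [e6]
  nlinarith [hq, hs, Nat.zero_le (r * r), Nat.zero_le (a₂ * r), Nat.zero_le (j * r), Nat.zero_le (a₂ * j),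
    Nat.zero_le (a₂ * a₂), Nat.zero_le (a₂ * a₂ * r), Nat.zero_le (a₂ * r * r), Nat.zero_le (a₂ * j * r)]

/-- **THE CONJECTURE §10av, VERBATIM, IS A THEOREM:** for every `k ≥ 6` and every `m ≤ ⌊k²/4⌋` there are the least
product `δ = min {a (k − a) : a ≤ k, a (k − a) ≥ m}`, `r = δ − m`, and the attained maximum `M` of the cherry count
over the `K₄⁻`-free graphs on `Fin k` with `m` edges, with
`2M = max (2·STAR(k, m)) (m (k − 2) − r (k − 1 − r))`, `STAR(k, m) = C(m, 2)` for `m ≤ k − 1` and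
`C(k − 1, 2) + 2 (m + 1 − k)` otherwise. -/
theorem closed_form_conjecture (k m : ℕ) (hk : 6 ≤ k) (hm : 4 * m ≤ k * k) :
    ∃ δ r M, ((∃ a, a ≤ k ∧ δ = a * (k - a)) ∧ m ≤ δ ∧
        (∀ a', a' ≤ k → m ≤ a' * (k - a') → δ ≤ a' * (k - a'))) ∧
      δ = m + r ∧
      (∀ (D : SimpleGraph (Fin k)) [DecidableRel D.Adj], K4mFree D → D.edgeFinset.card = m →
        cherries D ≤ M) ∧
      (∃ (D : SimpleGraph (Fin k)) (_ : DecidableRel D.Adj), K4mFree D ∧ D.edgeFinset.card = m ∧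
        cherries D = M) ∧
      2 * M = max (2 * (if m + 1 ≤ k then m.choose 2 else (k - 1).choose 2 + 2 * (m + 1 - k)))
        (m * (k - 2) - r * (k - 1 - r)) := by
  rcases Nat.lt_or_ge (m + 3) (2 * k) with hlow | hdense
  · -- the table region `m ≤ 2k − 4`
    obtain ⟨h1, h2⟩ := table_km k m (by omega)
    by_cases hmk : m + 1 ≤ k
    · -- `m ≤ k − 1`: `δ = k − 1` (or `0` when `m = 0`), both terms are `C(m, 2)`
      simp only [if_pos hmk] at h1 h2 ⊢
      rcases Nat.eq_zero_or_pos m with hm0 | hm0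
      · subst hm0
        refine ⟨0, 0, 0, ⟨⟨0, by omega, by simp⟩, le_refl 0, fun a' _ _ => Nat.zero_le _⟩, rfl, ?_, ?_, by simp⟩
        · intro D _ hK hD
          have := h1 D hK hD
          simpa using this
        · simpa using h2
      · refine ⟨k - 1, k - 1 - m, m.choose 2, ⟨⟨1, by omega, by simp⟩, by omega,
          least_prod_of_le k m (by omega) hm0 hmk⟩, by omega, h1, h2, ?_⟩
        have e1 : k - 1 - (k - 1 - m) = m := by omega
        rw [e1]
        have h2c : 2 * m.choose 2 = m * (m - 1) := by
          obtain ⟨m', rfl⟩ : ∃ m', m = m' + 1 := ⟨m - 1, by omega⟩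
          rw [two_mul_choose_two_succ, Nat.add_sub_cancel]
        have e2 : m * (k - 2) - (k - 1 - m) * m = m * (m - 1) := by
          obtain ⟨m', rfl⟩ : ∃ m', m = m' + 1 := ⟨m - 1, by omega⟩
          obtain ⟨c, hc⟩ : ∃ c, k = m' + 1 + 1 + c := ⟨k - (m' + 2), by omega⟩
          rw [hc]
          have e3 : m' + 1 + 1 + c - 2 = m' + c := by omega
          have e4 : m' + 1 + 1 + c - 1 - (m' + 1) = c := by omega
          have e5 : m' + 1 - 1 = m' := by omega
          rw [e3, e4, e5]
          have : (m' + 1) * (m' + c) = (m' + 1) * m' + c * (m' + 1) := by ring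
          omega
        rw [e2, h2c, max_self]
    · -- `k ≤ m ≤ 2k − 4`: `δ = 2 (k − 2)`, the second term is the value `C(k−2, 2) + C(t+1, 2) + t + 1`
      simp only [if_neg hmk] at h1 h2 ⊢
      push Not at hmk
      refine ⟨2 * (k - 2), 2 * (k - 2) - m, _, ⟨⟨2, by omega, rfl⟩, by omega,
        least_prod_of_mid k m (by omega) (by omega) (by omega)⟩, by omega, h1, h2, ?_⟩
      -- the arithmetic: `2 (C(k−2, 2) + C(t+1, 2) + t + 1) = m (k − 2) − r (k − 1 − r)` with `t = m + 1 − k`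
      obtain ⟨t, ht⟩ : ∃ t, m = k - 1 + t := ⟨m + 1 - k, by omega⟩
      obtain ⟨c, hc⟩ : ∃ c, k = t + 3 + c := ⟨k - (t + 3), by omega⟩
      have e1 : m + 2 - k = t + 1 := by omega
      have e2 : m + 1 - k = t := by omega
      rw [e1, e2]
      have h3 : 2 * (k - 2).choose 2 = (k - 2) * (k - 3) := by
        obtain ⟨d, hd⟩ : ∃ d, k - 2 = d + 1 := ⟨k - 3, by omega⟩
        rw [hd, two_mul_choose_two_succ]
        have : k - 3 = d := by omega
        rw [this]
      have h4 : 2 * (t + 1).choose 2 = (t + 1) * t := two_mul_choose_two_succ t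
      have h5 : 2 * (k - 1).choose 2 = (k - 1) * (k - 2) := by
        obtain ⟨d, hd⟩ : ∃ d, k - 1 = d + 1 := ⟨k - 2, by omega⟩
        rw [hd, two_mul_choose_two_succ]
        have : k - 2 = d := by omega
        rw [this]
      have e3 : 2 * (k - 2) - m = k - 3 - t := by omega
      have e4 : k - 1 - (k - 3 - t) = t + 2 := by omega
      rw [e3, e4]
      have key : m * (k - 2) - (k - 3 - t) * (t + 2) = (k - 2) * (k - 3) + (t + 1) * t + 2 * (t + 1) := by
        rw [ht, hc]
        have f1 : t + 3 + c - 1 + t = 2 * t + 2 + c := by omega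
        have f2 : t + 3 + c - 2 = t + 1 + c := by omega
        have f3 : t + 3 + c - 3 - t = c := by omega
        have f4 : t + 3 + c - 3 = t + c := by omega
        rw [f1, f2, f3, f4]
        have : (2 * t + 2 + c) * (t + 1 + c) = c * (t + 2) + ((t + 1 + c) * (t + c) + (t + 1) * t + 2 * (t + 1)) := by
          ring
        omega
      rw [key]
      have hmax : 2 * max ((k - 1).choose 2 + 2 * t) ((k - 2).choose 2 + (t + 1).choose 2 + (t + 1)) =
          max (2 * ((k - 1).choose 2 + 2 * t)) (2 * ((k - 2).choose 2 + (t + 1).choose 2 + (t + 1))) := by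
        rcases le_total ((k - 1).choose 2 + 2 * t) ((k - 2).choose 2 + (t + 1).choose 2 + (t + 1)) with h | h
        · rw [max_eq_right h, max_eq_right (by omega)]
        · rw [max_eq_left h, max_eq_left (by omega)]
      have hB : 2 * ((k - 2).choose 2 + (t + 1).choose 2 + (t + 1)) =
          (k - 2) * (k - 3) + (t + 1) * t + 2 * (t + 1) := by omega
      rw [hmax, hB]
  · -- the dense corner: the closed form, the star term dominated
    obtain ⟨r, hrk, ⟨a, ha, hak, hcell⟩, h1, D₀, inst, hK₀, hm₀, hc₀⟩ := closed_form_km k m hk hdense hm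
    refine ⟨m + r, r, cherries D₀, ⟨⟨a, by omega, hcell.symm⟩, by omega, fun a' ha' hma' => ?_⟩, rfl, ?_,
      ⟨D₀, inst, hK₀, hm₀, rfl⟩, ?_⟩
    · have := least_prod_of_cell k a r m ha hak hcell a' ha' hma'
      omega
    · intro D _ hK hD
      have := h1 D hK hD
      omega
    · have hstar := star_le_closed k a r m ha hak hcell
      have hmk : ¬ (m + 1 ≤ k) := by omega
      simp only [if_neg hmk]
      have h5 : 2 * (k - 1).choose 2 = (k - 1) * (k - 2) := by
        obtain ⟨d, hd⟩ : ∃ d, k - 1 = d + 1 := ⟨k - 2, by omega⟩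
        rw [hd, two_mul_choose_two_succ]
        have : k - 2 = d := by omega
        rw [this]
      rw [max_eq_right (by omega)]
      omega

end C047

end TriangleCap

end PercRepro
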